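import Summits.QuantumFields.YangMills.Theorems.UnitScaleTiltProp7LineMeanOscLetters
import HarnessLib

/-!
# Route `UnitScaleTilt`, crux K1 «MinimiserStabilityRegPr» (stmt-QuantumFields-19200), route-R [RP] curved, row (n3) N3b, file 2d (ii-a) —
# THE OSCILLATION ROW OF THE STRAIGHT-LINE MEAN: `osc_{V̄}(LINE_VZ) ≤ L^{2−d}·osc_V(Z) + d·L^{1−d}·(6a + 8L²a′)·‖Z‖_{ℓ¹}`
# (the `LINE-osc` hypothesis `hLINE` of the two-channel damped engine ✓∕⧗ `…Prop7TrueLinSourcedOscL1`, with `ρ₂ = (L^d)⁻¹L²`)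

Cell `ym3-torus`, D-0154 (3c) extra-width seat `ym-routeR-w6` (gen 3); sequel of the letters file ✓∕⧗ `…Prop7LineMeanOscLetters`; LEAD ★p1 g13's NAMED row 2d (ii-a)
(2026-08-28 13:46Z ∕ 14:02Z).  THEOREMS ONLY (0 `def`, 0 `sorry`); `--supports stmt-QuantumFields-19200`, count-neutral.  YM₃ on T³ is a ladder rung (R3), not the Clay
problem; nothing here claims the stub, the crux, d = 4 or the mass gap.

THE POINT.  `osc` is the `ℓ¹` covariant gradient of ✓ A2 `sum_normSq_covGrad_le_mass`'s summand, `osc_V(Z) = Σ_bΣ_ν‖V(b₋,ν)·Z(b+e_ν)·V(b₋,ν)* − Z(b)‖`; at the coarse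
level the background is `V̄ = avgFun ℰ V` (the next tower level, `rfl`).  Per coarse bond `c`, direction `ν` and comb index `i` the letters file bounds the coarse covariant
`ν`-difference of the comb term by `Σ_{t<L}Σ_{s<L}‖∇^V_νZ(x_r + te_μ + se_ν, μ)‖ + (6a + 8L²a′)·Σ_{t<L}‖Z(x_r′ + te_μ, μ)‖`; here the comb mean `|I|⁻¹Σ_i` becomes
`(L^d)⁻¹Σ_r` (✓ `sum_idx_of_fst`, `card_idx`), and the sums over `(c, r, t)` and over the `s`-shifts are the two `L`-to-one reparametrisations of ✓ `Prop7TrueLinLineBound`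
(`sum_coarse_offsets_shifts`, `sum_shift_iterate`) — `(L^d)⁻¹·L·L = L^{2−d}` on the oscillation, `(L^d)⁻¹·L` (times `d` directions) on the mass leak.  With the
CM-osc row of ★routeR-w2 (`hCM`) this is the k-uniform, `log`-free reading of the door's third row (LEAD's crit4 numerics: level-0 sources damped `≈ L²` per level).

WHAT IS PROVED (ns `…Theorems.Prop7LineMeanOsc`; `SU`-type background of any rank, any `P`, one level `j + 1 ≤ m + K`).
* `norm_coarseDiff_line_le` — the coarse covariant `ν`-difference of `LINE_VZ` at one `(c, ν)` against `(L^d)⁻¹Σ_r` of the comb bounds.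
* `sum_leak_reindex`, `sum_main_reindex` — the two reparametrisations.
* ★★ `osc_line_le` — the title.
HONEST SCOPE.  Bookkeeping over the letters file and the tree's counting lemmas; the loop sizes `a` (all (0.4) loop variables of `V` at level `j+1`, `a ≤ 1/6`, `a < δ_N`) and the
plaquette size `a′` of `V` are displayed; nothing of [Balaban1984PropagatorsI] ∕ [Balaban1985Averaging] is asserted beyond the cited tree theorems.

References: T. Bałaban, CMP 95 (1984) 17–40 [Balaban1984PropagatorsI] ((1.11), (1.18)–(1.20) pp.19–20); CMP 98 (1985) 17–51 [Balaban1985Averaging] ((9) p.19, Prop. 3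
(125) p.36); CMP 109 (1987) 249–301 [Balaban1987RG1] ((0.3)–(0.4) pp.252–253).
-/

set_option autoImplicit false

noncomputable section

open scoped BigOperators Matrix.Norms.L2Operator

namespace Summit.QuantumFields.YangMills.Theorems.Prop7LineMeanOsc

open Literature.MathematicalPhysics.QuantumFieldTheory.Balaban1983to89
open Finset T4Continuum BlockAveraging AveragingRT ExpMeanLog BlockAveragingEMLLinearised BlockAveragingEMLLinearisedBackground BlockAveragingEMLProp2
open Summit.QuantumFields.YangMills.Theorems.Prop7LineMeanOscLetters (norm_coarseDiff_combTerm_le)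
open Summit.QuantumFields.YangMills.Theorems.Prop7TrueLinLineBound (sum_coarse_offsets_shifts sum_shift_iterate)
open Summit.QuantumFields.YangMills.Theorems.Prop7FlatCoercivity (sum_shift)
open B10StarCount (sum_pbond)

variable {P : Params} {n : Type*} [Fintype n] [DecidableEq n] [Nonempty n] {j : ℕ}

/-! ## §1 One coarse bond and direction: the comb mean of the comb bounds -/

/-- **THE COARSE COVARIANT `ν`-DIFFERENCE OF `LINE_VZ` AT ONE `(c, ν)`** is at most `(L^d)⁻¹·Σ_r` of the comb bounds of the letters file (norm of the mean ≤ mean of the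
norms; the two permutation indices are idle, ✓ `sum_idx_of_fst`, `card_idx`). [cite: Balaban1985Averaging, Prop. 3 (125) p.36; Balaban1987RG1, (0.4) p.253] -/
theorem norm_coarseDiff_line_le (V : GaugeField P j (Matrix.specialUnitaryGroup n ℂ)) (Z : PBond P j → Matrix n n ℂ) (c : PBond P (j + 1)) (ν : Fin P.d)
    {a a' : ℝ} (ha0 : 0 ≤ a) (hα : ∀ i : Idx P, dist1 (loopHol V ⟨c.src, ν⟩ i) ≤ a) (haN : a < deltaSU n) (ha6 : a ≤ 1 / 6)
    (ha' : 0 ≤ a') (hV : ∀ q : Plaq P j, dist1 (GaugeField.plaqHol V q) ≤ a') :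
    ‖((avgFun (expMeanLogSU (n := n)) V ⟨c.src, ν⟩ : Matrix.specialUnitaryGroup n ℂ) : Matrix n n ℂ) * (((Fintype.card (Idx P) : ℂ))⁻¹ • ∑ i : Idx P,
          ((holAt V (walk (emb (c.src.shift ν)) (stairWord i.2.1 (off i.1))) : Matrix.specialUnitaryGroup n ℂ) : Matrix n n ℂ) *
            covWalkSum V Z (walk (walkEnd (emb (c.src.shift ν)) (stairWord i.2.1 (off i.1))) (List.replicate P.L (c.dir, true))) *
          star ((holAt V (walk (emb (c.src.shift ν)) (stairWord i.2.1 (off i.1))) : Matrix.specialUnitaryGroup n ℂ) : Matrix n n ℂ)) * star ((avgFun (expMeanLogSU (n := n)) V ⟨c.src, ν⟩ : Matrix.specialUnitaryGroup n ℂ) : Matrix n n ℂ)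
        - (((Fintype.card (Idx P) : ℂ))⁻¹ • ∑ i : Idx P,
          ((holAt V (walk (emb c.src) (stairWord i.2.1 (off i.1))) : Matrix.specialUnitaryGroup n ℂ) : Matrix n n ℂ) *
            covWalkSum V Z (walk (walkEnd (emb c.src) (stairWord i.2.1 (off i.1))) (List.replicate P.L (c.dir, true))) *
          star ((holAt V (walk (emb c.src) (stairWord i.2.1 (off i.1))) : Matrix.specialUnitaryGroup n ℂ) : Matrix n n ℂ))‖
      ≤ ((P.L : ℝ) ^ P.d)⁻¹ * ∑ r : Fin P.d → Fin P.L, ((∑ t ∈ Finset.range P.L, ∑ s ∈ Finset.range P.L, ‖(((V ⟨((fun z : Site P j => z.shift ν)^[s] ((fun z : Site P j => z.shift c.dir)^[t] (Site.blockSite c.src r))), ν⟩ : Matrix.specialUnitaryGroup n ℂ) : Matrix n n ℂ) * Z ⟨Site.shift (((fun z : Site P j => z.shift ν)^[s] ((fun z : Site P j => z.shift c.dir)^[t] (Site.blockSite c.src r)))) ν, c.dir⟩ * star ((V ⟨((fun z : Site P j => z.shift ν)^[s] ((fun z : Site P j => z.shift c.dir)^[t] (Site.blockSite c.src r))), ν⟩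 : Matrix.specialUnitaryGroup n ℂ) : Matrix n n ℂ) - Z ⟨((fun z : Site P j => z.shift ν)^[s] ((fun z : Site P j => z.shift c.dir)^[t] (Site.blockSite c.src r))), c.dir⟩)‖) + (6 * a + 8 * (P.L : ℝ) ^ 2 * a') * (∑ t ∈ Finset.range P.L, ‖Z ⟨((fun z : Site P j => z.shift c.dir)^[t] (Site.blockSite (c.src.shift ν) r)), c.dir⟩‖)) := by
  have hI : (0 : ℝ) < (Fintype.card (Idx P) : ℝ) := by exact_mod_cast Fintype.card_pos
  -- pull the mean out: `Ad(V̄)(|I|⁻¹ΣW′) − |I|⁻¹ΣW = |I|⁻¹Σ(Ad(V̄)W′ − W)`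
  have e : ((avgFun (expMeanLogSU (n := n)) V ⟨c.src, ν⟩ : Matrix.specialUnitaryGroup n ℂ) : Matrix n n ℂ) * (((Fintype.card (Idx P) : ℂ))⁻¹ • ∑ i : Idx P,
          ((holAt V (walk (emb (c.src.shift ν)) (stairWord i.2.1 (off i.1))) : Matrix.specialUnitaryGroup n ℂ) : Matrix n n ℂ) *
            covWalkSum V Z (walk (walkEnd (emb (c.src.shift ν)) (stairWord i.2.1 (off i.1))) (List.replicate P.L (c.dir, true))) *
          star ((holAt V (walk (emb (c.src.shift ν)) (stairWord i.2.1 (off i.1))) : Matrix.specialUnitaryGroup n ℂ) : Matrix n n ℂ)) * star ((avgFun (expMeanLogSU (n := n)) V ⟨c.src, ν⟩ : Matrix.specialUnitaryGroup n ℂ) : Matrix n n ℂ) - (((Fintype.card (Idx P) : ℂ))⁻¹ • ∑ i : Idx P,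
          ((holAt V (walk (emb c.src) (stairWord i.2.1 (off i.1))) : Matrix.specialUnitaryGroup n ℂ) : Matrix n n ℂ) *
            covWalkSum V Z (walk (walkEnd (emb c.src) (stairWord i.2.1 (off i.1))) (List.replicate P.L (c.dir, true))) *
          star ((holAt V (walk (emb c.src) (stairWord i.2.1 (off i.1))) : Matrix.specialUnitaryGroup n ℂ) : Matrix n n ℂ))
      = ((Fintype.card (Idx P) : ℂ))⁻¹ • ∑ i : Idx P,
          (((avgFun (expMeanLogSU (n := n)) V ⟨c.src, ν⟩ : Matrix.specialUnitaryGroup n ℂ) : Matrix n n ℂ) * (((holAt V (walk (emb (c.src.shift ν)) (stairWord i.2.1 (off i.1))) : Matrix.specialUnitaryGroup n ℂ) : Matrix n n ℂ) * covWalkSum V Z (walk (walkEnd (emb (c.src.shift ν)) (stairWord i.2.1 (off i.1))) (List.replicate P.L (c.dir, true))) * star ((holAt V (walk (emb (c.src.shift ν)) (stairWord i.2.1 (off i.1))) : Matrix.specialUnitaryGroup n ℂ) : Matrix n n ℂ)) * star ((avgFun (expMeanLogSU (n := n)) V ⟨c.src, ν⟩ : Matrix.specialUnitaryGroup n ℂ)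 : Matrix n n ℂ)
            - ((holAt V (walk (emb c.src) (stairWord i.2.1 (off i.1))) : Matrix.specialUnitaryGroup n ℂ) : Matrix n n ℂ) * covWalkSum V Z (walk (walkEnd (emb c.src) (stairWord i.2.1 (off i.1))) (List.replicate P.L (c.dir, true))) * star ((holAt V (walk (emb c.src) (stairWord i.2.1 (off i.1))) : Matrix.specialUnitaryGroup n ℂ) : Matrix n n ℂ)) := by
    rw [Finset.sum_sub_distrib, smul_sub, Finset.smul_sum, Finset.smul_sum, Finset.smul_sum, Finset.mul_sum, Finset.sum_mul]
    congr 1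
    refine Finset.sum_congr rfl fun i _ => ?_
    rw [mul_smul_comm, smul_mul_assoc]
  rw [e, norm_smul, norm_inv, Complex.norm_natCast]
  calc (Fintype.card (Idx P) : ℝ)⁻¹ * ‖∑ i : Idx P,
          (((avgFun (expMeanLogSU (n := n)) V ⟨c.src, ν⟩ : Matrix.specialUnitaryGroup n ℂ) : Matrix n n ℂ) * (((holAt V (walk (emb (c.src.shift ν)) (stairWord i.2.1 (off i.1))) : Matrix.specialUnitaryGroup n ℂ) : Matrix n n ℂ) * covWalkSum V Z (walk (walkEnd (emb (c.src.shift ν)) (stairWord i.2.1 (off i.1))) (List.replicate P.L (c.dir, true))) * star ((holAt V (walk (emb (c.src.shift ν)) (stairWord i.2.1 (off i.1))) : Matrix.specialUnitaryGroup n ℂ) : Matrix n n ℂ)) * star ((avgFun (expMeanLogSU (n := n)) V ⟨c.src, ν⟩ : Matrix.specialUnitaryGroup n ℂ) : Matrix n n ℂ)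
            - ((holAt V (walk (emb c.src) (stairWord i.2.1 (off i.1))) : Matrix.specialUnitaryGroup n ℂ) : Matrix n n ℂ) * covWalkSum V Z (walk (walkEnd (emb c.src) (stairWord i.2.1 (off i.1))) (List.replicate P.L (c.dir, true))) * star ((holAt V (walk (emb c.src) (stairWord i.2.1 (off i.1))) : Matrix.specialUnitaryGroup n ℂ) : Matrix n n ℂ))‖
      ≤ (Fintype.card (Idx P) : ℝ)⁻¹ * ∑ i : Idx P, ((fun r : Fin P.d → Fin P.L => (∑ t ∈ Finset.range P.L, ∑ s ∈ Finset.range P.L, ‖(((V ⟨((fun z : Site P j => z.shift ν)^[s] ((fun z : Site P j => z.shift c.dir)^[t] (Site.blockSite c.src r))), ν⟩ : Matrix.specialUnitaryGroup n ℂ) : Matrix n n ℂ) * Z ⟨Site.shift (((fun z : Site P j => z.shift ν)^[s] ((fun z : Site P j => z.shift c.dir)^[t] (Site.blockSite c.src r)))) ν, c.dir⟩ * star ((V ⟨((fun z : Site P j => z.shift ν)^[s] ((fun z : Site P j => z.shift c.dir)^[t] (Site.blockSite c.src r))), ν⟩ : Matrix.specialUnitaryGroup n ℂ) : Matrix n n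 ℂ) - Z ⟨((fun z : Site P j => z.shift ν)^[s] ((fun z : Site P j => z.shift c.dir)^[t] (Site.blockSite c.src r))), c.dir⟩)‖) + (6 * a + 8 * (P.L : ℝ) ^ 2 * a') * (∑ t ∈ Finset.range P.L, ‖Z ⟨((fun z : Site P j => z.shift c.dir)^[t] (Site.blockSite (c.src.shift ν) r)), c.dir⟩‖)) i.1) :=
        mul_le_mul_of_nonneg_left ((norm_sum_le _ _).trans (Finset.sum_le_sum fun i _ =>
          norm_coarseDiff_combTerm_le V Z c ν i.1 i.2.1 ha0 hα haN ha6 ha' hV)) (by positivity)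
    _ = ((P.L : ℝ) ^ P.d)⁻¹ * ∑ r : Fin P.d → Fin P.L, ((∑ t ∈ Finset.range P.L, ∑ s ∈ Finset.range P.L, ‖(((V ⟨((fun z : Site P j => z.shift ν)^[s] ((fun z : Site P j => z.shift c.dir)^[t] (Site.blockSite c.src r))), ν⟩ : Matrix.specialUnitaryGroup n ℂ) : Matrix n n ℂ) * Z ⟨Site.shift (((fun z : Site P j => z.shift ν)^[s] ((fun z : Site P j => z.shift c.dir)^[t] (Site.blockSite c.src r)))) ν, c.dir⟩ * star ((V ⟨((fun z : Site P j => z.shift ν)^[s] ((fun z : Site P j => z.shift c.dir)^[t] (Site.blockSite c.src r))), ν⟩ : Matrix.specialUnitaryGroup n ℂ) : Matrix n n ℂ) - Z ⟨((fun z : Site P j => z.shift ν)^[s] ((fun z : Site P j => z.shift c.dir)^[t] (Site.blockSite c.src r))), c.dir⟩)‖) + (6 * a + 8 * (P.L : ℝ) ^ 2 * a') * (∑ t ∈ Finset.range P.L, ‖Z ⟨((fun z : Site P j => z.shift c.dir)^[t] (Site.blockSite (c.src.shift ν) r)), c.dir⟩‖)) := by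
        rw [sum_idx_of_fst (fun r : Fin P.d → Fin P.L => (∑ t ∈ Finset.range P.L, ∑ s ∈ Finset.range P.L, ‖(((V ⟨((fun z : Site P j => z.shift ν)^[s] ((fun z : Site P j => z.shift c.dir)^[t] (Site.blockSite c.src r))), ν⟩ : Matrix.specialUnitaryGroup n ℂ) : Matrix n n ℂ) * Z ⟨Site.shift (((fun z : Site P j => z.shift ν)^[s] ((fun z : Site P j => z.shift c.dir)^[t] (Site.blockSite c.src r)))) ν, c.dir⟩ * star ((V ⟨((fun z : Site P j => z.shift ν)^[s] ((fun z : Site P j => z.shift c.dir)^[t] (Site.blockSite c.src r))), ν⟩ : Matrix.specialUnitaryGroup n ℂ) : Matrix n n ℂ) - Z ⟨((fun z : Site P j => z.shift ν)^[s] ((fun z : Site P j => z.shift c.dir)^[t] (Site.blockSite c.src r))), c.dir⟩)‖) + (6 * a + 8 * (P.L : ℝ) ^ 2 * a') * (∑ t ∈ Finset.range P.L, ‖Z ⟨((fun z : Site P j => z.shift c.dir)^[t] (Site.blockSite (c.src.shift ν) r)), c.dir⟩‖)), card_idx, nsmul_eq_mul]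
        have hS : (0 : ℝ) < (Fintype.card (Equiv.Perm (Fin P.d)) : ℝ) := by exact_mod_cast Fintype.card_pos
        have hL : (0 : ℝ) < (P.L : ℝ) ^ P.d := by have := P.L_pos; positivity
        push_cast
        field_simp

/-! ## §2 The two reparametrisations -/

omit [Nonempty n] in
/-- **THE LEAK REINDEXED**: `Σ_νΣ_cΣ_rΣ_{t<L}‖Z(blockSite (c₋+e_ν) r + te_{μ_c}, μ_c)‖ = d·L·Σ_b‖Z b‖` (translate the coarse source by `−e_ν`, then the `L`-to-one line
reparametrisation ✓ `sum_coarse_offsets_shifts`). [cite: Balaban1984PropagatorsI, (1.11) p.19] -/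
theorem sum_leak_reindex (hj : j + 1 ≤ P.m + P.K) (Z : PBond P j → Matrix n n ℂ) :
    ∑ c : PBond P (j + 1), ∑ ν : Fin P.d, ∑ r : Fin P.d → Fin P.L, (∑ t ∈ Finset.range P.L, ‖Z ⟨((fun z : Site P j => z.shift c.dir)^[t] (Site.blockSite (c.src.shift ν) r)), c.dir⟩‖) = P.d * ((P.L : ℝ) * ∑ b : PBond P j, ‖Z b‖) := by
  have hν : ∀ ν : Fin P.d, ∑ c : PBond P (j + 1), ∑ r : Fin P.d → Fin P.L, (∑ t ∈ Finset.range P.L, ‖Z ⟨((fun z : Site P j => z.shift c.dir)^[t] (Site.blockSite (c.src.shift ν) r)), c.dir⟩‖) = (P.L : ℝ) * ∑ b : PBond P j, ‖Z b‖ := by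
    intro ν
    have hshift : ∑ c : PBond P (j + 1), ∑ r : Fin P.d → Fin P.L, (∑ t ∈ Finset.range P.L, ‖Z ⟨((fun z : Site P j => z.shift c.dir)^[t] (Site.blockSite (c.src.shift ν) r)), c.dir⟩‖)
        = ∑ c : PBond P (j + 1), ∑ r : Fin P.d → Fin P.L, ∑ t ∈ Finset.range P.L, ‖Z ⟨((fun z : Site P j => z.shift c.dir)^[t] (Site.blockSite c.src r)), c.dir⟩‖ := by
      rw [sum_pbond (fun c : PBond P (j + 1) => ∑ r : Fin P.d → Fin P.L, (∑ t ∈ Finset.range P.L, ‖Z ⟨((fun z : Site P j => z.shift c.dir)^[t] (Site.blockSite (c.src.shift ν) r)), c.dir⟩‖)),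
        sum_pbond (fun c : PBond P (j + 1) => ∑ r : Fin P.d → Fin P.L, ∑ t ∈ Finset.range P.L, ‖Z ⟨((fun z : Site P j => z.shift c.dir)^[t] (Site.blockSite c.src r)), c.dir⟩‖)]
      exact sum_shift ν (fun y : Site P (j + 1) => ∑ μ : Fin P.d, ∑ r : Fin P.d → Fin P.L, ∑ t ∈ Finset.range P.L,
        ‖Z ⟨(fun z : Site P j => z.shift μ)^[t] (Site.blockSite y r), μ⟩‖)
    rw [hshift, sum_coarse_offsets_shifts hj (fun b : PBond P j => ‖Z b‖)]
  calc ∑ c : PBond P (j + 1), ∑ ν : Fin P.d, ∑ r : Fin P.d → Fin P.L, (∑ t ∈ Finset.range P.L, ‖Z ⟨((fun z : Site P j => z.shift c.dir)^[t] (Site.blockSite (c.src.shift ν) r)), c.dir⟩‖)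
      = ∑ ν : Fin P.d, ∑ c : PBond P (j + 1), ∑ r : Fin P.d → Fin P.L, (∑ t ∈ Finset.range P.L, ‖Z ⟨((fun z : Site P j => z.shift c.dir)^[t] (Site.blockSite (c.src.shift ν) r)), c.dir⟩‖) := Finset.sum_comm
    _ = ∑ _ν : Fin P.d, (P.L : ℝ) * ∑ b : PBond P j, ‖Z b‖ := Finset.sum_congr rfl fun ν _ => hν ν
    _ = P.d * ((P.L : ℝ) * ∑ b : PBond P j, ‖Z b‖) := by rw [Finset.sum_const, Finset.card_univ, Fintype.card_fin, nsmul_eq_mul]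

omit [Nonempty n] in
/-- **THE MAIN TERM REINDEXED**: `Σ_νΣ_cΣ_rΣ_{t<L}Σ_{s<L}‖∇^V_νZ(blockSite c₋ r + te_{μ_c} + se_ν, μ_c)‖ = L·L·Σ_bΣ_ν‖∇^V_νZ(b)‖` (the line reparametrisation
✓ `sum_coarse_offsets_shifts`, then the `s`-shifts ✓ `sum_shift_iterate`). [cite: Balaban1984PropagatorsI, (1.11), (1.18) pp.19-20] -/
theorem sum_main_reindex (hj : j + 1 ≤ P.m + P.K) (V : GaugeField P j (Matrix.specialUnitaryGroup n ℂ)) (Z : PBond P j → Matrix n n ℂ) :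
    ∑ c : PBond P (j + 1), ∑ ν : Fin P.d, ∑ r : Fin P.d → Fin P.L, (∑ t ∈ Finset.range P.L, ∑ s ∈ Finset.range P.L, ‖(((V ⟨((fun z : Site P j => z.shift ν)^[s] ((fun z : Site P j => z.shift c.dir)^[t] (Site.blockSite c.src r))), ν⟩ : Matrix.specialUnitaryGroup n ℂ) : Matrix n n ℂ) * Z ⟨Site.shift (((fun z : Site P j => z.shift ν)^[s] ((fun z : Site P j => z.shift c.dir)^[t] (Site.blockSite c.src r)))) ν, c.dir⟩ * star ((V ⟨((fun z : Site P j => z.shift ν)^[s] ((fun z : Site P j => z.shift c.dir)^[t] (Site.blockSite c.src r))), ν⟩ : Matrix.specialUnitaryGroup n ℂ) : Matrix n n ℂ) - Z ⟨((fun z : Site P j => z.shift ν)^[s] ((fun z : Site P j => z.shift c.dir)^[t] (Site.blockSite c.src r))), c.dir⟩)‖)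
      = (P.L : ℝ) * ((P.L : ℝ) * ∑ b : PBond P j, ∑ ν : Fin P.d,
          ‖((V ⟨b.src, ν⟩ : Matrix.specialUnitaryGroup n ℂ) : Matrix n n ℂ) * Z ⟨b.src.shift ν, b.dir⟩ * star ((V ⟨b.src, ν⟩ : Matrix.specialUnitaryGroup n ℂ) : Matrix n n ℂ) - Z b‖) := by
  have hν : ∀ ν : Fin P.d, ∑ c : PBond P (j + 1), ∑ r : Fin P.d → Fin P.L, (∑ t ∈ Finset.range P.L, ∑ s ∈ Finset.range P.L, ‖(((V ⟨((fun z : Site P j => z.shift ν)^[s] ((fun z : Site P j => z.shift c.dir)^[t] (Site.blockSite c.src r))), ν⟩ : Matrix.specialUnitaryGroup n ℂ) : Matrix n n ℂ) * Z ⟨Site.shift (((fun z : Site P j => z.shift ν)^[s] ((fun z : Site P j => z.shift c.dir)^[t] (Site.blockSite c.src r)))) ν, c.dir⟩ * star ((V ⟨((fun z : Site P j => z.shift ν)^[s] ((fun z : Site P j => z.shift c.dir)^[t] (Site.blockSite c.src r))), ν⟩ : Matrix.specialUnitaryGroup n ℂ) : Matrix n n ℂ) - Z ⟨((fun z : Site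 P j => z.shift ν)^[s] ((fun z : Site P j => z.shift c.dir)^[t] (Site.blockSite c.src r))), c.dir⟩)‖)
      = (P.L : ℝ) * ((P.L : ℝ) * ∑ b : PBond P j, ‖(((V ⟨b.src, ν⟩ : Matrix.specialUnitaryGroup n ℂ) : Matrix n n ℂ) * Z ⟨Site.shift (b.src) ν, b.dir⟩ * star ((V ⟨b.src, ν⟩ : Matrix.specialUnitaryGroup n ℂ) : Matrix n n ℂ) - Z ⟨b.src, b.dir⟩)‖) := by
    intro ν
    rw [sum_coarse_offsets_shifts hj (fun b : PBond P j => ∑ s ∈ Finset.range P.L, ‖(((V ⟨((fun z : Site P j => z.shift ν)^[s] b.src), ν⟩ : Matrix.specialUnitaryGroup n ℂ) : Matrix n n ℂ) * Z ⟨Site.shift (((fun z : Site P j => z.shift ν)^[s] b.src)) ν, b.dir⟩ * star ((V ⟨((fun z : Site P j => z.shift ν)^[s] b.src), ν⟩ : Matrix.specialUnitaryGroup n ℂ) : Matrix n n ℂ) - Z ⟨((fun z : Site P j => z.shift ν)^[s] b.src), b.dir⟩)‖),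
      Finset.sum_comm]
    congr 1
    calc ∑ s ∈ Finset.range P.L, ∑ b : PBond P j, ‖(((V ⟨((fun z : Site P j => z.shift ν)^[s] b.src), ν⟩ : Matrix.specialUnitaryGroup n ℂ) : Matrix n n ℂ) * Z ⟨Site.shift (((fun z : Site P j => z.shift ν)^[s] b.src)) ν, b.dir⟩ * star ((V ⟨((fun z : Site P j => z.shift ν)^[s] b.src), ν⟩ : Matrix.specialUnitaryGroup n ℂ) : Matrix n n ℂ) - Z ⟨((fun z : Site P j => z.shift ν)^[s] b.src), b.dir⟩)‖
        = ∑ _s ∈ Finset.range P.L, ∑ b : PBond P j, ‖(((V ⟨b.src, ν⟩ : Matrix.specialUnitaryGroup n ℂ) : Matrix n n ℂ) * Z ⟨Site.shift (b.src) ν, b.dir⟩ * star ((V ⟨b.src, ν⟩ : Matrix.specialUnitaryGroup n ℂ) : Matrix n n ℂ) - Z ⟨b.src, b.dir⟩)‖ := by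
          refine Finset.sum_congr rfl fun s _ => ?_
          rw [sum_pbond (fun b : PBond P j => ‖(((V ⟨((fun z : Site P j => z.shift ν)^[s] b.src), ν⟩ : Matrix.specialUnitaryGroup n ℂ) : Matrix n n ℂ) * Z ⟨Site.shift (((fun z : Site P j => z.shift ν)^[s] b.src)) ν, b.dir⟩ * star ((V ⟨((fun z : Site P j => z.shift ν)^[s] b.src), ν⟩ : Matrix.specialUnitaryGroup n ℂ) : Matrix n n ℂ) - Z ⟨((fun z : Site P j => z.shift ν)^[s] b.src), b.dir⟩)‖),
            sum_pbond (fun b : PBond P j => ‖(((V ⟨b.src, ν⟩ : Matrix.specialUnitaryGroup n ℂ) : Matrix n n ℂ) * Z ⟨Site.shift (b.src) ν, b.dir⟩ * star ((V ⟨b.src, ν⟩ : Matrix.specialUnitaryGroup n ℂ) : Matrix n n ℂ) - Z ⟨b.src, b.dir⟩)‖)]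
          exact sum_shift_iterate ν (fun x : Site P j => ∑ μ : Fin P.d, ‖(((V ⟨x, ν⟩ : Matrix.specialUnitaryGroup n ℂ) : Matrix n n ℂ) * Z ⟨Site.shift (x) ν, μ⟩ * star ((V ⟨x, ν⟩ : Matrix.specialUnitaryGroup n ℂ) : Matrix n n ℂ) - Z ⟨x, μ⟩)‖) s
      _ = (P.L : ℝ) * ∑ b : PBond P j, ‖(((V ⟨b.src, ν⟩ : Matrix.specialUnitaryGroup n ℂ) : Matrix n n ℂ) * Z ⟨Site.shift (b.src) ν, b.dir⟩ * star ((V ⟨b.src, ν⟩ : Matrix.specialUnitaryGroup n ℂ) : Matrix n n ℂ) - Z ⟨b.src, b.dir⟩)‖ := by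
          rw [Finset.sum_const, Finset.card_range, nsmul_eq_mul]
  have hb : ∀ b : PBond P j, ∑ ν : Fin P.d, ‖(((V ⟨b.src, ν⟩ : Matrix.specialUnitaryGroup n ℂ) : Matrix n n ℂ) * Z ⟨Site.shift (b.src) ν, b.dir⟩ * star ((V ⟨b.src, ν⟩ : Matrix.specialUnitaryGroup n ℂ) : Matrix n n ℂ) - Z ⟨b.src, b.dir⟩)‖
      = ∑ ν : Fin P.d, ‖((V ⟨b.src, ν⟩ : Matrix.specialUnitaryGroup n ℂ) : Matrix n n ℂ) * Z ⟨b.src.shift ν, b.dir⟩ * star ((V ⟨b.src, ν⟩ : Matrix.specialUnitaryGroup n ℂ) : Matrix n n ℂ) - Z b‖ := by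
    rintro ⟨x, μ⟩; rfl
  calc ∑ c : PBond P (j + 1), ∑ ν : Fin P.d, ∑ r : Fin P.d → Fin P.L, (∑ t ∈ Finset.range P.L, ∑ s ∈ Finset.range P.L, ‖(((V ⟨((fun z : Site P j => z.shift ν)^[s] ((fun z : Site P j => z.shift c.dir)^[t] (Site.blockSite c.src r))), ν⟩ : Matrix.specialUnitaryGroup n ℂ) : Matrix n n ℂ) * Z ⟨Site.shift (((fun z : Site P j => z.shift ν)^[s] ((fun z : Site P j => z.shift c.dir)^[t] (Site.blockSite c.src r)))) ν, c.dir⟩ * star ((V ⟨((fun z : Site P j => z.shift ν)^[s] ((fun z : Site P j => z.shift c.dir)^[t] (Site.blockSite c.src r))), ν⟩ : Matrix.specialUnitaryGroup n ℂ) : Matrix n n ℂ) - Z ⟨((fun z : Site P j => z.shift ν)^[s] ((fun z : Site P j => z.shift c.dir)^[t] (Site.blockSite c.src r))), c.dir⟩)‖)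
      = ∑ ν : Fin P.d, ∑ c : PBond P (j + 1), ∑ r : Fin P.d → Fin P.L, (∑ t ∈ Finset.range P.L, ∑ s ∈ Finset.range P.L, ‖(((V ⟨((fun z : Site P j => z.shift ν)^[s] ((fun z : Site P j => z.shift c.dir)^[t] (Site.blockSite c.src r))), ν⟩ : Matrix.specialUnitaryGroup n ℂ) : Matrix n n ℂ) * Z ⟨Site.shift (((fun z : Site P j => z.shift ν)^[s] ((fun z : Site P j => z.shift c.dir)^[t] (Site.blockSite c.src r)))) ν, c.dir⟩ * star ((V ⟨((fun z : Site P j => z.shift ν)^[s] ((fun z : Site P j => z.shift c.dir)^[t] (Site.blockSite c.src r))), ν⟩ : Matrix.specialUnitaryGroup n ℂ) : Matrix n n ℂ) - Z ⟨((fun z : Site P j => z.shift ν)^[s] ((fun z : Site P j => z.shift c.dir)^[t] (Site.blockSite c.src r))), c.dir⟩)‖) := Finset.sum_comm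
    _ = ∑ ν : Fin P.d, (P.L : ℝ) * ((P.L : ℝ) * ∑ b : PBond P j, ‖(((V ⟨b.src, ν⟩ : Matrix.specialUnitaryGroup n ℂ) : Matrix n n ℂ) * Z ⟨Site.shift (b.src) ν, b.dir⟩ * star ((V ⟨b.src, ν⟩ : Matrix.specialUnitaryGroup n ℂ) : Matrix n n ℂ) - Z ⟨b.src, b.dir⟩)‖) := Finset.sum_congr rfl fun ν _ => hν ν
    _ = (P.L : ℝ) * ((P.L : ℝ) * ∑ b : PBond P j, ∑ ν : Fin P.d, ‖(((V ⟨b.src, ν⟩ : Matrix.specialUnitaryGroup n ℂ) : Matrix n n ℂ) * Z ⟨Site.shift (b.src) ν, b.dir⟩ * star ((V ⟨b.src, ν⟩ : Matrix.specialUnitaryGroup n ℂ) : Matrix n n ℂ) - Z ⟨b.src, b.dir⟩)‖) := by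
        rw [← Finset.mul_sum, ← Finset.mul_sum]
        congr 2
        exact Finset.sum_comm
    _ = (P.L : ℝ) * ((P.L : ℝ) * ∑ b : PBond P j, ∑ ν : Fin P.d,
          ‖((V ⟨b.src, ν⟩ : Matrix.specialUnitaryGroup n ℂ) : Matrix n n ℂ) * Z ⟨b.src.shift ν, b.dir⟩ * star ((V ⟨b.src, ν⟩ : Matrix.specialUnitaryGroup n ℂ) : Matrix n n ℂ) - Z b‖) := by
        rw [Finset.sum_congr rfl fun b _ => hb b]

/-! ## §3 ★★ The oscillation row of the straight-line mean -/

/-- ★★ **THE OSCILLATION ROW OF THE STRAIGHT-LINE MEAN** (`hLINE` of ✓∕⧗ `…Prop7TrueLinSourcedOscL1` with `ρ₂ = (L^d)⁻¹L²`).  Level `j + 1 ≤ m + K`, background `V`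
(`SU(N)`), coarse background `V̄ = avgFun ℰ V`; all (0.4) loop variables of `V` at the coarse bonds within `a` of `1` (`0 ≤ a ≤ 1/6`, `a < δ_N`), all plaquette variables
within `a′`.  Then for every bond field `Z`:
`Σ_cΣ_ν‖V̄(c₋,ν)·LINE_VZ(c+e_ν)·V̄(c₋,ν)* − LINE_VZ(c)‖ ≤ (L^d)⁻¹L²·Σ_bΣ_ν‖V(b₋,ν)Z(b+e_ν)V(b₋,ν)* − Z(b)‖ + d·((L^d)⁻¹L)·(6a + 8L²a′)·Σ_b‖Z b‖`.
[cite: Balaban1984PropagatorsI, (1.11), (1.18)-(1.20) pp.19-20; Balaban1985Averaging, (9) p.19, Prop. 3 (125) p.36; Balaban1987RG1, (0.3)-(0.4) pp.252-253] -/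
theorem osc_line_le (hj : j + 1 ≤ P.m + P.K) (V : GaugeField P j (Matrix.specialUnitaryGroup n ℂ)) (Z : PBond P j → Matrix n n ℂ)
    {a a' : ℝ} (ha0 : 0 ≤ a) (hα : ∀ (C : PBond P (j + 1)) (i : Idx P), dist1 (loopHol V C i) ≤ a) (haN : a < deltaSU n) (ha6 : a ≤ 1 / 6)
    (ha' : 0 ≤ a') (hV : ∀ q : Plaq P j, dist1 (GaugeField.plaqHol V q) ≤ a') :
    ∑ c : PBond P (j + 1), ∑ ν : Fin P.d,
        ‖((avgFun (expMeanLogSU (n := n)) V ⟨c.src, ν⟩ : Matrix.specialUnitaryGroup n ℂ) : Matrix n n ℂ) * (((Fintype.card (Idx P) : ℂ))⁻¹ • ∑ i : Idx P,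
          ((holAt V (walk (emb (c.src.shift ν)) (stairWord i.2.1 (off i.1))) : Matrix.specialUnitaryGroup n ℂ) : Matrix n n ℂ) *
            covWalkSum V Z (walk (walkEnd (emb (c.src.shift ν)) (stairWord i.2.1 (off i.1))) (List.replicate P.L (c.dir, true))) *
          star ((holAt V (walk (emb (c.src.shift ν)) (stairWord i.2.1 (off i.1))) : Matrix.specialUnitaryGroup n ℂ) : Matrix n n ℂ)) * star ((avgFun (expMeanLogSU (n := n)) V ⟨c.src, ν⟩ : Matrix.specialUnitaryGroup n ℂ) : Matrix n n ℂ)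
          - (((Fintype.card (Idx P) : ℂ))⁻¹ • ∑ i : Idx P,
          ((holAt V (walk (emb c.src) (stairWord i.2.1 (off i.1))) : Matrix.specialUnitaryGroup n ℂ) : Matrix n n ℂ) *
            covWalkSum V Z (walk (walkEnd (emb c.src) (stairWord i.2.1 (off i.1))) (List.replicate P.L (c.dir, true))) *
          star ((holAt V (walk (emb c.src) (stairWord i.2.1 (off i.1))) : Matrix.specialUnitaryGroup n ℂ) : Matrix n n ℂ))‖
      ≤ ((P.L : ℝ) ^ P.d)⁻¹ * (P.L : ℝ) ^ 2 * (∑ b : PBond P j, ∑ ν : Fin P.d,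
          ‖((V ⟨b.src, ν⟩ : Matrix.specialUnitaryGroup n ℂ) : Matrix n n ℂ) * Z ⟨b.src.shift ν, b.dir⟩ * star ((V ⟨b.src, ν⟩ : Matrix.specialUnitaryGroup n ℂ) : Matrix n n ℂ) - Z b‖)
        + P.d * (((P.L : ℝ) ^ P.d)⁻¹ * (P.L : ℝ)) * (6 * a + 8 * (P.L : ℝ) ^ 2 * a') * ∑ b : PBond P j, ‖Z b‖ := by
  have hLpos : (0 : ℝ) < (P.L : ℝ) := by exact_mod_cast P.L_pos
  have hLd : (0 : ℝ) ≤ ((P.L : ℝ) ^ P.d)⁻¹ := by positivity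
  calc _ ≤ ∑ c : PBond P (j + 1), ∑ ν : Fin P.d, ((P.L : ℝ) ^ P.d)⁻¹ * ∑ r : Fin P.d → Fin P.L, ((∑ t ∈ Finset.range P.L, ∑ s ∈ Finset.range P.L, ‖(((V ⟨((fun z : Site P j => z.shift ν)^[s] ((fun z : Site P j => z.shift c.dir)^[t] (Site.blockSite c.src r))), ν⟩ : Matrix.specialUnitaryGroup n ℂ) : Matrix n n ℂ) * Z ⟨Site.shift (((fun z : Site P j => z.shift ν)^[s] ((fun z : Site P j => z.shift c.dir)^[t] (Site.blockSite c.src r)))) ν, c.dir⟩ * star ((V ⟨((fun z : Site P j => z.shift ν)^[s] ((fun z : Site P j => z.shift c.dir)^[t] (Site.blockSite c.src r))), ν⟩ : Matrix.specialUnitaryGroup n ℂ) : Matrix n n ℂ) - Z ⟨((fun z : Site P j => z.shift ν)^[s] ((fun z : Site P j => z.shift c.dir)^[t] (Site.blockSite c.src r))), c.dir⟩)‖) + (6 * a + 8 * (P.L : ℝ) ^ 2 * a') * (∑ t ∈ Finset.range P.L, ‖Z ⟨((fun z : Site P j => z.shift c.dir)^[t] (Site.blockSite (c.src.shift ν) r)),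 c.dir⟩‖)) :=
        Finset.sum_le_sum fun c _ => Finset.sum_le_sum fun ν _ => norm_coarseDiff_line_le V Z c ν ha0 (hα ⟨c.src, ν⟩) haN ha6 ha' hV
    _ = ((P.L : ℝ) ^ P.d)⁻¹ * ∑ c : PBond P (j + 1), ∑ ν : Fin P.d, ∑ r : Fin P.d → Fin P.L, ((∑ t ∈ Finset.range P.L, ∑ s ∈ Finset.range P.L, ‖(((V ⟨((fun z : Site P j => z.shift ν)^[s] ((fun z : Site P j => z.shift c.dir)^[t] (Site.blockSite c.src r))), ν⟩ : Matrix.specialUnitaryGroup n ℂ) : Matrix n n ℂ) * Z ⟨Site.shift (((fun z : Site P j => z.shift ν)^[s] ((fun z : Site P j => z.shift c.dir)^[t] (Site.blockSite c.src r)))) ν, c.dir⟩ * star ((V ⟨((fun z : Site P j => z.shift ν)^[s] ((fun z : Site P j => z.shift c.dir)^[t] (Site.blockSite c.src r))), ν⟩ : Matrix.specialUnitaryGroup n ℂ) : Matrix n n ℂ) - Z ⟨((fun z : Site P j => z.shift ν)^[s] ((fun z : Site P j => z.shift c.dir)^[t] (Site.blockSite c.src r))), c.dir⟩)‖) + (6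 * a + 8 * (P.L : ℝ) ^ 2 * a') * (∑ t ∈ Finset.range P.L, ‖Z ⟨((fun z : Site P j => z.shift c.dir)^[t] (Site.blockSite (c.src.shift ν) r)), c.dir⟩‖)) := by
        rw [Finset.mul_sum]
        refine Finset.sum_congr rfl fun c _ => ?_
        rw [Finset.mul_sum]
    _ = ((P.L : ℝ) ^ P.d)⁻¹ * (∑ c : PBond P (j + 1), ∑ ν : Fin P.d, ∑ r : Fin P.d → Fin P.L, (∑ t ∈ Finset.range P.L, ∑ s ∈ Finset.range P.L, ‖(((V ⟨((fun z : Site P j => z.shift ν)^[s] ((fun z : Site P j => z.shift c.dir)^[t] (Site.blockSite c.src r))), ν⟩ : Matrix.specialUnitaryGroup n ℂ) : Matrix n n ℂ) * Z ⟨Site.shift (((fun z : Site P j => z.shift ν)^[s] ((fun z : Site P j => z.shift c.dir)^[t] (Site.blockSite c.src r)))) ν, c.dir⟩ * star ((V ⟨((fun z : Site P j => z.shift ν)^[s] ((fun z : Site P j => z.shift c.dir)^[t] (Site.blockSite c.src r))), ν⟩ : Matrix.specialUnitaryGroup n ℂ) : Matrix n n ℂ) - Z ⟨((fun z : Site P j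 => z.shift ν)^[s] ((fun z : Site P j => z.shift c.dir)^[t] (Site.blockSite c.src r))), c.dir⟩)‖)
          + (6 * a + 8 * (P.L : ℝ) ^ 2 * a') * ∑ c : PBond P (j + 1), ∑ ν : Fin P.d, ∑ r : Fin P.d → Fin P.L, (∑ t ∈ Finset.range P.L, ‖Z ⟨((fun z : Site P j => z.shift c.dir)^[t] (Site.blockSite (c.src.shift ν) r)), c.dir⟩‖)) := by
        congr 1
        rw [Finset.mul_sum, ← Finset.sum_add_distrib]
        refine Finset.sum_congr rfl fun c _ => ?_
        rw [Finset.mul_sum, ← Finset.sum_add_distrib]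
        refine Finset.sum_congr rfl fun ν _ => ?_
        rw [Finset.mul_sum, ← Finset.sum_add_distrib]
    _ = _ := by
        rw [sum_main_reindex hj V Z, sum_leak_reindex hj Z]
        ring

end Summit.QuantumFields.YangMills.Theorems.Prop7LineMeanOsc

end
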